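import Mathlib
import Literature.Computability.Complexity.OccurrenceObstructionsIPProofs
import Literature.Computability.Complexity.OccurrenceObstructionsIPHookPositivity
import Literature.NumberTheory.DiophantineGeometry.PowerTraceOrbitBound
import Summits.ValiantsHypothesis.ValiantsHypothesis.Theorems.ValuativeGCTValuativeFlipDetEquationDivisibility

/-!
# Stability of the equation count of `Det_m` along the first row (partition form)

Wall-breaker axis D (det-orbit-closure multiplicity bounds) for crux `ValuativeGCT.ValuativeFlip`
(stmt-ValiantsHypothesis-12624): the partition reading of
`plethysmCoeff_sub_orbitMultiplicity_detFormLex_eq` (`…DetEquationDivisibility`).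

For `λ ⊢ mδ` with at most `m²` parts write `λ + (m)` for `λ` with `m` boxes added to its first row
(`Nat.Partition.rowAdd λ (m)`, a partition of `mδ + m = m(δ+1)`, same body `λ̄`).  Its weight is
`(λ + (m))* = λ* - m ε_top` (`partitionWeightLex_rowAdd_indiscrete`), and

* `det_equationCount_rowAdd` — **`a_{λ+(m)}((δ+1)[m]) - K_m((λ+(m))*) = a_λ(δ[m]) - K_m(λ*)` whenever
  `bodySize λ ≤ δ + m`**: the number of (highest-weight) equations of `Δ(det_m)` of a type is
  unchanged by adding `m` to the first row, from degree `bodySize λ - m` on.  Equivalently, at fixed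
  body `λ̄` of size `b`, `δ ↦ a_{(mδ-b; λ̄)}(δ[m]) - K_m` is constant for `δ ≥ b - m`; every equation of
  `Det_m` of body `b` is `X_{d₀}^{δ-δ₀}` times one of degree `δ₀ = b - m`.

No definitions. [new]
-/

set_option linter.dupNamespace false

namespace Summit.ValiantsHypothesis.ValiantsHypothesis.Theorems.ValuativeFlip

open MvPolynomial
open scoped BigOperators Matrix
open Literature.NumberTheory.DiophantineGeometry
open Literature.Computability.AlgebraicComplexity
open Literature.Computability.Complexity

noncomputable section

/-- Every matrix index is below the top index `matIdxEquiv m (m² - 1)`. [folklore] -/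
theorem le_matIdxEquiv_top {m : ℕ} (hmm : 0 < m * m) (i : MatIdx m) :
    i ≤ matIdxEquiv m ⟨m * m - 1, Nat.sub_one_lt_of_lt hmm⟩ := by
  rw [← (matIdxEquiv m).apply_symm_apply i, (matIdxEquiv m).le_iff_le]
  exact Fin.le_iff_val_le_val.mpr (Nat.le_sub_one_of_lt ((matIdxEquiv m).symm i).2)

/-- **The weight of `λ + (m)`**: adding `m` boxes to the first row subtracts `m ε_top` from the
dual weight: `(λ + (m))* = λ* + (-m) ε_top`. [folklore] -/
theorem partitionWeightLex_rowAdd_indiscrete {m N : ℕ} (hmm : 0 < m * m) (lam : Nat.Partition N) (M : ℕ) :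
    partitionWeightLex m (lam.rowAdd (Nat.Partition.indiscrete M)) =
      partitionWeightLex m lam +
        Pi.single (matIdxEquiv m ⟨m * m - 1, Nat.sub_one_lt_of_lt hmm⟩) (-(M : ℤ)) := by
  classical
  funext y
  rw [Pi.add_apply, partitionWeightLex_apply, partitionWeightLex_apply,
    getD_sortedParts_rowAdd_indiscrete, Nat.cast_add, neg_add]
  congr 1
  by_cases hy : y = matIdxEquiv m ⟨m * m - 1, Nat.sub_one_lt_of_lt hmm⟩
  · rw [hy, Pi.single_eq_same, OrderIso.symm_apply_apply, if_pos (by simp only; omega)]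
  · rw [Pi.single_eq_of_ne hy, if_neg]
    · simp
    · intro h
      apply hy
      apply (matIdxEquiv m).symm.injective
      rw [OrderIso.symm_apply_apply]
      apply Fin.ext
      have := ((matIdxEquiv m).symm y).2
      simp only
      omega

/-- The first row of `λ + (M)` is `λ₁ + M`. [folklore] -/
theorem sup_parts_rowAdd_indiscrete {N : ℕ} (lam : Nat.Partition N) (M : ℕ) :
    (lam.rowAdd (Nat.Partition.indiscrete M)).parts.sup = lam.parts.sup + M := by
  rw [sup_parts_eq_getD_sortedParts, sup_parts_eq_getD_sortedParts, getD_sortedParts_rowAdd_indiscrete,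
    if_pos rfl]

/-- **Stability of the equation count of `Det_m` along the first row.**  For `λ ⊢ mδ` with at most
`m²` parts and `bodySize λ ≤ δ + m`, adding `m` boxes to the first row does not change the number of
highest-weight equations of `Δ(det_m)` of that type:
`a_{λ+(m)} - K_m((λ+(m))*) = a_λ - K_m(λ*)` (plethysm coefficient minus det-orbit-closure multiplicity,
both as `plethysmCoeff` / `orbitMultiplicity` of the transported dual weights).  Partition form of
`plethysmCoeff_sub_orbitMultiplicity_detFormLex_eq`; registered sub-goal of the crux (wall-breaker k7,
axis D). [new] -/
theorem det_equationCount_rowAdd (m δ : ℕ) [NeZero m] (lam : Nat.Partition (m * δ))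
    (hlam : lam.parts.card ≤ m * m) (hbody : bodySize lam ≤ δ + m) :
    plethysmCoeff ℂ (MatIdx m) m (partitionWeightLex m (lam.rowAdd (Nat.Partition.indiscrete m))) -
        orbitMultiplicity ℂ (detFormLex ℂ m) m (partitionWeightLex m (lam.rowAdd (Nat.Partition.indiscrete m))) =
      plethysmCoeff ℂ (MatIdx m) m (partitionWeightLex m lam) -
        orbitMultiplicity ℂ (detFormLex ℂ m) m (partitionWeightLex m lam) := by
  classical
  have hm : 0 < m := Nat.pos_of_ne_zero (NeZero.ne m)
  have hmm : 0 < m * m := Nat.mul_pos hm hm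
  set top : MatIdx m := matIdxEquiv m ⟨m * m - 1, Nat.sub_one_lt_of_lt hmm⟩ with htop
  set lamP : Nat.Partition (m * δ + m) := lam.rowAdd (Nat.Partition.indiscrete m) with hlamP
  -- bookkeeping for `λ + (m)`
  have hcardP : lamP.parts.card ≤ m * m := by
    refine (card_parts_rowAdd_le _ _).trans (max_le hlam ?_)
    rw [Nat.Partition.indiscrete_parts hm.ne', Multiset.card_singleton]
    exact hmm
  have hχ : partitionWeightLex m lamP - Pi.single top (-(m : ℤ)) = partitionWeightLex m lam := by
    rw [hlamP, partitionWeightLex_rowAdd_indiscrete hmm, htop, add_sub_cancel_right]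
  have hsize : (partitionWeightLex m lamP).size = -((m * (δ + 1) : ℕ) : ℤ) := by
    rw [Nat.mul_succ]
    exact size_toMatIdx_dualOfPartition' lamP hcardP
  have hb : ((m * (δ + 1) : ℕ) : ℤ) + partitionWeightLex m lamP top = (bodySize lam : ℤ) := by
    rw [htop, partitionWeightLex_apply_top hmm, hlamP, sup_parts_rowAdd_indiscrete]
    unfold bodySize
    have hsup := sup_parts_le lam
    push_cast
    rw [Nat.cast_sub hsup]
    push_cast
    ring
  have hle : bodySize lam + 1 ≤ (δ + 1) + m := by omega
  have key := plethysmCoeff_sub_orbitMultiplicity_detFormLex_eq (k := ℂ) top (le_matIdxEquiv_top hmm)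
    (partitionWeightLex m lamP) (δ + 1) (bodySize lam) hsize hb hle
  rw [hχ] at key
  exact key

end

end Summit.ValiantsHypothesis.ValiantsHypothesis.Theorems.ValuativeFlip
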